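import Summits.CriticalPhenomena.PercolationContinuityZ3.Theorems.PercNearOneGluingNoHeavyLowerTailSahiCombMasterFamily
import Summits.CriticalPhenomena.PercolationContinuityZ3.Theorems.SahiMasterFamilyTensorisation
import Literature.Probability.LatticeModels.ProdBernoulliBK
import Literature.Combinatorics.Sahi2008.PushForward

/-!
# The comb (tensor-Bernstein) hierarchy for Sahi's `E_k`, X: the law of total cumulance / block stratum (R8) AT THE COMB LEVEL, every `k`

Support file of the one-cut programme (crux `NoHeavyLowerTail`, stmt-CriticalPhenomena-4575; cell `prim-masterthm`, seat P3, gen 3;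
`run/shared/lean/prim/prim-masterthm/prim-masterthm-p3/HIERARCHY.md` §10).  Vocabulary: `SahiComb.CombPos`, `MasterFamilyCombPos k` = (M⁺-k)
(`…SahiCombPositivity`, `…SahiCombMasterFamily`), and unit P4's law of total cumulance in tensor form
`SahiTotalCumulance.sahiE_prod_tensor_eq` (`SahiMasterFamilyTensorisation`):
  `E^{μ⊗ν}_{n+1}(φ⊗ψ) = Σ_{π ∈ Part([n+1])} [Π_{B∈π} E^μ_{|B|}(φ_B)] · E^ν_{|π|}(Π_{i∈B} ψ_i : B ∈ π)`.

THE POINT.  For a product measure `μ_p` on `2^ι` and a coordinate bipartition `ι = F ⊔ Fᶜ`, `μ_p` is the image of `μ_p ⊗ μ_p` under the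
RESAMPLING COUPLING `(α, β) ↦ (α ∩ F) ∪ (β ∖ F)` (`pushWeight_couple`), so for a SEPARABLE family `U_i = V_i ∩ W_i` (`V_i` determined by
`F`, `W_i` by `Fᶜ`) the identity reads, with ALL SIGNS PLUS (`sahiE_ind_separable_eq`),
  `E_{n+1}(μ_p; 1_U) = Σ_π [Π_{B∈π} E_{|B|}(μ_p; 1_{V_B})] · E_{|π|}(μ_p; (1_{⋂_{i∈B} W_i})_{B∈π})`.
Each factor `E_{|B|}(μ_p; 1_{V_B})` ignores the coordinates of `Fᶜ` and each `E_{|π|}(μ_p; 1_{⋂W})` those of `F`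
(`sahiE_bernoulliWeight_update_eq_of_diff`, through the push-forward `E_{p[T↦0]}[h] = E_p[h(· ∖ T)]`, `ex_bernoulliWeight_kill`, dual to the
freezing lemma of `…SahiCombMasterFamily`), so a comb certificate of multidegree `|B|` (resp. `|π| ≤ n+1`) restricts to `|B|` on `F` and `0` on
`Fᶜ` (resp. `n+1` on `Fᶜ`, `0` on `F`) (`SahiComb.CombPos.of_ignores_finset`), and the product has multidegree `(Σ_B |B|)·1_F + (n+1)·1_{Fᶜ} = n+1`
(`SahiComb.CombPos.prod`, `sum_card_block`).  Hence:
* `combPos_sahiE_ind_separable_local` — comb positivity of a separable family from comb positivity of the sub-families of `V` and of the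
  block-intersection families `(⋂_{i∈B} W_i)_{B∈π}` of `W` (LOCAL hypotheses; the unconditional rows of the companion file `…SahiCombTensorRows`
  — crossed chains at every order, two independent groups of `≤ 2` slots — are instances);
* `combPos_sahiE_ind_separable` — GIVEN (M⁺-j) for `j ≤ n+1`, every separable family of `n+1` increasing events is comb-positive at
  multidegree `n+1`: the comb lift of the law-level stratum R8 (MASTER-ROUTES §P4.8 (d), `SahiTotalCumulance.sahiE_prod_blocks_nonneg`);
  `combPos_sahiE_ind_of_blocks` — two independent GROUPS of slots (disconnected dependency graph); its one-slot case is
  `combPos_sahiE_ind_of_indepMember` of `…SahiCombStrata`.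
With this file every law-level stratum of the `k → k+1` step (nested, independent member, zero flag, total meet, cylinder, block) is at the
comb level.  HONEST FRAMING: nothing here asserts (M⁺-k) or `C_k` for `k ≥ 3`. [this work]
-/

noncomputable section

open scoped Classical

namespace Summit.CriticalPhenomena.PercolationContinuityZ3.Theorems

open Finset Function
open Literature.Combinatorics.Sahi2008
open Literature.Combinatorics.Sahi2008.PartitionForm
open Literature.Probability.LatticeModels (prodBernoulli)
open Literature.Probability.Percolation (DeterminedBy determinedBy_iff determinedBy_univ)
open Literature.Probability.Percolation.DecisionTree (ind ind_of_mem ind_of_not_mem ind_nonneg)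
open Literature.Probability.Percolation.BHK2006 (weight ind_inter)
open SahiComb SahiTotalCumulance

section CombPosAlgebra

variable {ι : Type*}

/-! ### Restriction of comb certificates at ignored coordinates; products of certificates -/

/-- **Restriction at a SET of ignored coordinates**: if `G` does not depend on `p_e` for `e ∈ T`, a certificate of multidegree `c` yields one
with `c` replaced by `0` on `T`. [this work] -/
theorem SahiComb.CombPos.of_ignores_finset [Fintype ι] {c : ι → ℕ} {G : (ι → unitInterval) → ℝ} (h : CombPos c G) (T : Finset ι)
    (hG : ∀ e ∈ T, ∀ p s, G (update p e s) = G p) : CombPos (fun e => if e ∈ T then 0 else c e) G := by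
  induction T using Finset.induction_on with
  | empty => exact h.congr fun p => by simp
  | insert a T haT ih =>
    have h1 := (ih fun e he => hG e (Finset.mem_insert_of_mem he)).of_ignores a (hG a (Finset.mem_insert_self a T))
    have heq : update (fun e => if e ∈ T then 0 else c e) a 0 = fun e => if e ∈ insert a T then 0 else c e := by
      funext e
      by_cases hea : e = a
      · subst hea; simp
      · rw [update_of_ne hea]; simp [hea]
    rw [heq] at h1
    exact h1

/-- **Products of certificates over a finset**: multidegrees add up. [this work] -/
theorem SahiComb.CombPos.prod [Fintype ι] {κ : Type*} (s : Finset κ) {d : κ → ι → ℕ} {G : κ → (ι → unitInterval) → ℝ}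
    (h : ∀ k ∈ s, CombPos (d k) (G k)) : CombPos (∑ k ∈ s, d k) (fun p => ∏ k ∈ s, G k p) := by
  induction s using Finset.induction_on with
  | empty => simpa using combPos_one (ι := ι) 0
  | insert a s ha ih =>
    have h1 := (h a (Finset.mem_insert_self a s)).mul (ih fun k hk => h k (Finset.mem_insert_of_mem hk))
    rw [Finset.sum_insert ha]
    exact h1.congr fun p => by rw [Finset.prod_insert ha]

end CombPosAlgebra

namespace SahiCombTensor

variable {ι : Type} [Fintype ι]

/-! ### Killing coordinates: `μ_{p[T↦0]}` is the push-forward of `μ_p` under `ω ↦ ω ∖ T` -/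

/-- One-coordinate push-forward: `E_{p[e↦0]}[h] = E_p[h(· ∖ {e})]`. [folklore] -/
theorem ex_bernoulliWeight_update_zero (p : ι → unitInterval) (e : ι) (h : Set ι → ℝ) :
    ex (bernoulliWeight (update p e 0)) h = ex (bernoulliWeight p) (fun ω => h (ω \ {e})) := by
  have h1 := ex_update_eq p e 0 h
  have h2 := ex_update_eq p e (p e) (fun ω => h (ω \ {e}))
  rw [update_eq_self] at h2
  have h3 : ∀ b : Bool, secEx p e (fun ω => h (ω \ {e})) b = secEx p e h false := by
    intro b
    simp only [secEx]
    refine sum_congr rfl fun ω hω => ?_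
    have hω' : e ∉ ω := (Finset.mem_filter.1 hω).2
    have hd : ω \ {e} = ω := Set.sdiff_singleton_eq_self hω'
    cases b
    · simp only [Bool.false_eq_true, if_false, hd]
    · simp only [if_true, Bool.false_eq_true, if_false, Set.insert_sdiff_of_mem _ (Set.mem_singleton e), hd]
  rw [h1, h2, h3, h3]
  simp only [Set.Icc.coe_zero]
  ring

/-- **Push-forward along killing**: the product weight with the coordinates of `T` set to `0` is the image of `μ_p` under `ω ↦ ω ∖ T`:
`E_{p[T↦0]}[h] = E_p[h(· ∖ T)]` (dual of `ex_bernoulliWeight_freeze`). [folklore] -/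
theorem ex_bernoulliWeight_kill (p : ι → unitInterval) (T : Set ι) (h : Set ι → ℝ) :
    ex (bernoulliWeight fun e => if e ∈ T then 0 else p e) h = ex (bernoulliWeight p) (fun ω => h (ω \ T)) := by
  suffices key : ∀ (T : Finset ι) (h : Set ι → ℝ),
      ex (bernoulliWeight fun e => if e ∈ T then 0 else p e) h = ex (bernoulliWeight p) (fun ω => h (ω \ ↑T)) by
    have hT : (fun e => if e ∈ T then (0 : unitInterval) else p e) = fun e => if e ∈ T.toFinset then 0 else p e := by
      funext e; simp only [Set.mem_toFinset]
    rw [hT, key T.toFinset h]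
    simp only [Set.coe_toFinset]
  intro T
  induction T using Finset.induction_on with
  | empty => intro h; simp
  | insert a T haT ih =>
    intro h
    have hupd : (fun e => if e ∈ insert a T then (0 : unitInterval) else p e) =
        update (fun e => if e ∈ T then 0 else p e) a 0 := by
      funext e
      by_cases hea : e = a
      · subst hea; simp
      · rw [update_of_ne hea]; simp [hea]
    rw [hupd, ex_bernoulliWeight_update_zero, ih]
    refine congrArg _ (funext fun ω => ?_)
    rw [Finset.coe_insert, Set.sdiff_sdiff, Set.union_comm, ← Set.insert_eq]

/-- The killed weight is the push-forward of `μ_p` under `ω ↦ ω ∖ T`. [folklore] -/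
theorem pushWeight_bernoulliWeight_diff (p : ι → unitInterval) (T : Set ι) :
    pushWeight (bernoulliWeight p) (fun ω : Set ι => ω \ T) = bernoulliWeight fun e => if e ∈ T then 0 else p e := by
  funext y
  rw [pushWeight_eq_ex, ← ex_bernoulliWeight_kill p T (fun ω => if ω = y then (1 : ℝ) else 0), ex_def]
  simp only [mul_ite, mul_one, mul_zero, Finset.sum_ite_eq', Finset.mem_univ, if_true]

/-! ### Slots that ignore a coordinate set -/

/-- `E_k(μ_p)` of slots that ignore the coordinates of `T` equals `E_k` under the killed weight `μ_{p[T↦0]}`. [this work] -/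
theorem sahiE_bernoulliWeight_eq_kill (p : ι → unitInterval) (T : Set ι) {k : ℕ} (φ : Fin k → Set ι → ℝ)
    (hφ : ∀ i ω, φ i ω = φ i (ω \ T)) :
    sahiE (bernoulliWeight p) k φ = sahiE (bernoulliWeight fun e => if e ∈ T then 0 else p e) k φ := by
  rw [← pushWeight_bernoulliWeight_diff, sahiE_pushWeight]
  congr 1
  funext i ω
  exact hφ i ω

/-- **`E_k(μ_p)` of slots ignoring `T` does not depend on `p_e`, `e ∈ T`.** [this work] -/
theorem sahiE_bernoulliWeight_update_eq_of_diff (p : ι → unitInterval) (T : Set ι) {k : ℕ} (φ : Fin k → Set ι → ℝ)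
    (hφ : ∀ i ω, φ i ω = φ i (ω \ T)) {e : ι} (he : e ∈ T) (s : unitInterval) :
    sahiE (bernoulliWeight (update p e s)) k φ = sahiE (bernoulliWeight p) k φ := by
  rw [sahiE_bernoulliWeight_eq_kill _ T φ hφ, sahiE_bernoulliWeight_eq_kill p T φ hφ]
  congr 3
  funext e'
  by_cases hT : e' ∈ T
  · simp only [hT, if_true]
  · have hne : e' ≠ e := fun h => hT (h ▸ he)
    simp only [hT, if_false, update_of_ne hne]

omit [Fintype ι] in
/-- Indicators of an event determined by `S` ignore the complement: `1_A(ω) = 1_A(ω ∖ T)` whenever `(ω ∖ T) ∩ S = ω ∩ S`. [folklore] -/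
theorem ind_eq_ind_of_inter_eq {A : Set (Set ι)} {S : Set ι} (hA : DeterminedBy A S) {ω ω' : Set ι} (h : ω ∩ S = ω' ∩ S) :
    ind A ω = ind A ω' := by
  have key := (determinedBy_iff A S).1 hA ω ω' h
  by_cases hω : ω ∈ A
  · rw [ind_of_mem hω, ind_of_mem (key.1 hω)]
  · rw [ind_of_not_mem hω, ind_of_not_mem (fun h' => hω (key.2 h'))]

omit [Fintype ι] in
/-- An event determined by `↑F` ignores `(↑F)ᶜ`. [folklore] -/
theorem ind_eq_ind_diff_compl {A : Set (Set ι)} {F : Finset ι} (hA : DeterminedBy A (↑F : Set ι)) (ω : Set ι) :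
    ind A ω = ind A (ω \ (↑F : Set ι)ᶜ) :=
  ind_eq_ind_of_inter_eq hA (by ext e; simp only [Set.mem_inter_iff, Set.mem_sdiff, Set.mem_compl_iff, not_not]; tauto)

omit [Fintype ι] in
/-- An event determined by `(↑F)ᶜ` ignores `↑F`. [folklore] -/
theorem ind_eq_ind_diff {A : Set (Set ι)} {F : Finset ι} (hA : DeterminedBy A (↑F : Set ι)ᶜ) (ω : Set ι) :
    ind A ω = ind A (ω \ (↑F : Set ι)) :=
  ind_eq_ind_of_inter_eq hA (by ext e; simp only [Set.mem_inter_iff, Set.mem_sdiff, Set.mem_compl_iff]; tauto)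

/-! ### The resampling coupling `(α, β) ↦ (α ∩ F) ∪ (β ∖ F)` -/

omit [Fintype ι] in
/-- On `F` the coupled configuration `(α ∩ F) ∪ (β ∖ F)` is `α`. [folklore] -/
theorem couple_inter (F : Finset ι) (α β : Set ι) : (α ∩ ↑F ∪ β \ ↑F) ∩ ↑F = α ∩ ↑F := by
  ext e; simp only [Set.mem_inter_iff, Set.mem_union, Set.mem_sdiff, Finset.mem_coe]; tauto

omit [Fintype ι] in
/-- Off `F` the coupled configuration `(α ∩ F) ∪ (β ∖ F)` is `β`. [folklore] -/
theorem couple_diff (F : Finset ι) (α β : Set ι) : (α ∩ ↑F ∪ β \ ↑F) \ ↑F = β \ ↑F := by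
  ext e; simp only [Set.mem_sdiff, Set.mem_union, Set.mem_inter_iff, Finset.mem_coe]; tauto

omit [Fintype ι] in
/-- The fibre of the coupling `(α, β) ↦ (α ∩ F) ∪ (β ∖ F)` over `ω`. [folklore] -/
theorem couple_eq_iff (F : Finset ι) (α β ω : Set ι) :
    α ∩ ↑F ∪ β \ ↑F = ω ↔ α ∩ ↑F = ω ∩ ↑F ∧ β \ ↑F = ω \ ↑F := by
  constructor
  · intro h
    exact ⟨by rw [← couple_inter F α β, h], by rw [← couple_diff F α β, h]⟩
  · rintro ⟨h1, h2⟩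
    rw [h1, h2, Set.inter_union_sdiff]

/-- The `μ_p`-mass of a cylinder `{α | α ∩ F = ω ∩ F}` is the `F`-part of the weight of `ω`. [folklore] -/
theorem sum_bernoulliWeight_inter_eq (p : ι → unitInterval) (F : Finset ι) (ω : Set ι) :
    ∑ α : Set ι, (if α ∩ ↑F = ω ∩ ↑F then bernoulliWeight p α else 0) =
      ∏ e ∈ F, (if e ∈ ω then (p e : ℝ) else 1 - (p e : ℝ)) := by
  have hcyl : {α : Set ι | α ∩ ↑F = ω ∩ ↑F} =
      {α : Set ι | ∀ (i) (h : i ∈ F), i ∈ α ↔ (fun i : F => decide ((i : ι) ∈ ω)) ⟨i, h⟩ = true} := by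
    ext α
    simp only [Set.mem_setOf_eq, decide_eq_true_eq, Set.ext_iff, Set.mem_inter_iff, Finset.mem_coe]
    constructor
    · intro h i hi
      exact ⟨fun hα => ((h i).1 ⟨hα, hi⟩).1, fun hω => ((h i).2 ⟨hω, hi⟩).1⟩
    · intro h i
      constructor
      · rintro ⟨hα, hi⟩; exact ⟨(h i hi).1 hα, hi⟩
      · rintro ⟨hω, hi⟩; exact ⟨(h i hi).2 hω, hi⟩
  have h1 : ∑ α : Set ι, (if α ∩ ↑F = ω ∩ ↑F then bernoulliWeight p α else 0) =
      ex (bernoulliWeight p) (ind {α : Set ι | α ∩ ↑F = ω ∩ ↑F}) := by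
    rw [ex_def]
    refine sum_congr rfl fun α _ => ?_
    by_cases hα : α ∩ ↑F = ω ∩ ↑F
    · rw [if_pos hα, ind_of_mem (show α ∈ {α : Set ι | α ∩ ↑F = ω ∩ ↑F} from hα), mul_one]
    · rw [if_neg hα, ind_of_not_mem (show α ∉ {α : Set ι | α ∩ ↑F = ω ∩ ↑F} from hα), mul_zero]
  rw [h1, ex_bernoulliWeight_ind, hcyl]
  refine (Literature.Probability.LatticeModels.prodBernoulli_real_cylinder_pattern p F (fun i : F => decide ((i : ι) ∈ ω))).trans ?_
  rw [← Finset.prod_coe_sort F]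
  refine Finset.prod_congr rfl fun i _ => ?_
  simp only [decide_eq_true_eq]

/-- **The product measure is the image of `μ_p ⊗ μ_p` under the resampling coupling** `(α,β) ↦ (α ∩ F) ∪ (β ∖ F)`. [folklore] -/
theorem pushWeight_couple (p : ι → unitInterval) (F : Finset ι) :
    pushWeight (fun q : Set ι × Set ι => bernoulliWeight p q.1 * bernoulliWeight p q.2)
      (fun q : Set ι × Set ι => q.1 ∩ ↑F ∪ q.2 \ ↑F) = bernoulliWeight p := by
  funext ω
  rw [pushWeight_apply, Fintype.sum_prod_type]
  simp only [couple_eq_iff]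
  have hsplit : ∑ α : Set ι, ∑ β : Set ι, (if α ∩ ↑F = ω ∩ ↑F ∧ β \ ↑F = ω \ ↑F then bernoulliWeight p α * bernoulliWeight p β else 0)
      = (∑ α : Set ι, if α ∩ ↑F = ω ∩ ↑F then bernoulliWeight p α else 0) *
          ∑ β : Set ι, if β \ ↑F = ω \ ↑F then bernoulliWeight p β else 0 := by
    rw [Finset.sum_mul_sum]
    refine sum_congr rfl fun α _ => sum_congr rfl fun β _ => ?_
    by_cases h1 : α ∩ ↑F = ω ∩ ↑F <;> by_cases h2 : β \ ↑F = ω \ ↑F <;> simp [h1, h2]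
  rw [hsplit, sum_bernoulliWeight_inter_eq]
  have hdiff : ∀ β : Set ι, β \ ↑F = β ∩ ↑(Fᶜ) := fun β => by
    rw [Finset.coe_compl, Set.sdiff_eq]
  simp_rw [hdiff]
  rw [sum_bernoulliWeight_inter_eq, Finset.prod_mul_prod_compl]
  simp only [bernoulliWeight, weight]

/-- **`E_k(μ_p)` through the coupling**: `E_k(μ_p; f) = E_k(μ_p ⊗ μ_p; (α,β) ↦ f((α ∩ F) ∪ (β ∖ F)))`. [this work] -/
theorem sahiE_bernoulliWeight_eq_couple (p : ι → unitInterval) (F : Finset ι) {k : ℕ} (f : Fin k → Set ι → ℝ) :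
    sahiE (bernoulliWeight p) k f =
      sahiE (fun q : Set ι × Set ι => bernoulliWeight p q.1 * bernoulliWeight p q.2) k
        (fun i (q : Set ι × Set ι) => f i (q.1 ∩ ↑F ∪ q.2 \ ↑F)) := by
  conv_lhs => rw [← pushWeight_couple p F, sahiE_pushWeight]
  rfl

/-! ### The law of total cumulance for separable families under a product measure -/

omit [Fintype ι] in
/-- A product of indicators is the indicator of the intersection. [folklore] -/
theorem prod_ind_eq_ind_iInter {m : ℕ} (W : Fin m → Set (Set ι)) (y : Set ι) :
    ∏ j, ind (W j) y = ind (⋂ j, W j) y := by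
  by_cases hy : y ∈ ⋂ j, W j
  · rw [ind_of_mem hy]
    exact Finset.prod_eq_one fun j _ => ind_of_mem (Set.mem_iInter.1 hy j)
  · rw [ind_of_not_mem hy]
    obtain ⟨j, hj⟩ : ∃ j, y ∉ W j := by simpa [Set.mem_iInter] using hy
    exact Finset.prod_eq_zero (Finset.mem_univ j) (ind_of_not_mem hj)

omit [Fintype ι] in
/-- Block intersections of increasing events are increasing. [folklore] -/
theorem isUpperSet_blockInter {N : ℕ} {W : Fin N → Set (Set ι)} (hW : ∀ i, IsUpperSet (W i)) (c : OrderedFinpartition N)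
    (m : Fin c.length) : IsUpperSet (⋂ j : Fin (block c m).card, W ((block c m).orderEmbOfFin rfl j)) :=
  isUpperSet_iInter fun _ => hW _

/-- **Law of total cumulance for a separable family** `U_i = V_i ∩ W_i` (`V_i` determined by `F`, `W_i` by `Fᶜ`) under `μ_p`:
`E_{n+1}(μ_p; 1_U) = Σ_π [Π_{B∈π} E_{|B|}(μ_p; 1_{V_B})] · E_{|π|}(μ_p; (1_{⋂_{i∈B} W_i})_{B∈π})`. [this work] -/
theorem sahiE_ind_separable_eq (p : ι → unitInterval) (F : Finset ι) {n : ℕ} (V W : Fin (n + 1) → Set (Set ι))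
    (hV : ∀ i, DeterminedBy (V i) (↑F : Set ι)) (hW : ∀ i, DeterminedBy (W i) (↑F : Set ι)ᶜ) :
    sahiE (bernoulliWeight p) (n + 1) (fun i => ind (V i ∩ W i)) =
      ∑ c : OrderedFinpartition (n + 1),
        (∏ m : Fin c.length, sahiE (bernoulliWeight p) (block c m).card (fun j => ind (V ((block c m).orderEmbOfFin rfl j)))) *
          sahiE (bernoulliWeight p) c.length (fun m => ind (⋂ j : Fin (block c m).card, W ((block c m).orderEmbOfFin rfl j))) := by
  rw [sahiE_bernoulliWeight_eq_couple p F]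
  have hfam : (fun i (q : Set ι × Set ι) => ind (V i ∩ W i) (q.1 ∩ ↑F ∪ q.2 \ ↑F)) = fun i q => ind (V i) q.1 * ind (W i) q.2 := by
    funext i q
    rw [ind_inter, ind_eq_ind_of_inter_eq (hV i) (couple_inter F q.1 q.2),
      ind_eq_ind_of_inter_eq (S := (↑F : Set ι)ᶜ) (hW i) (ω' := q.2)]
    rw [← Set.sdiff_eq, ← Set.sdiff_eq, couple_diff]
  rw [hfam, sahiE_prod_tensor_eq]
  refine sum_congr rfl fun c _ => ?_
  congr 1
  congr 1
  funext m y
  exact prod_ind_eq_ind_iInter _ y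

/-! ### Comb positivity of separable families -/

/-- Blocks partition the slots: `Σ_m |block m| = N`. [folklore] -/
theorem sum_card_block {N : ℕ} (c : OrderedFinpartition N) : ∑ m : Fin c.length, (block c m).card = N := by
  have h := Finset.card_eq_sum_card_fiberwise (s := (univ : Finset (Fin N))) (t := (univ : Finset (Fin c.length)))
    (f := c.index) fun x _ => mem_univ _
  rw [Finset.card_univ, Fintype.card_fin] at h
  exact h.symm

/-- **Comb positivity of a separable family from LOCAL hypotheses.**  For `V_i` determined by `F`, `W_i` by `Fᶜ`: if every sub-family
functional `p ↦ E_{|B|}(μ_p; 1_{V_B})` is comb-positive at multidegree `|B|` and, for every set partition `π`, `p ↦ E_{|π|}(μ_p; (1_{⋂_B W})_{B∈π})`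
is comb-positive at multidegree `|π|`, then `p ↦ E_{n+1}(μ_p; 1_{V_0 ∩ W_0},…,1_{V_n ∩ W_n})` is comb-positive at multidegree `n+1`. [this work] -/
theorem combPos_sahiE_ind_separable_local (F : Finset ι) {n : ℕ} (V W : Fin (n + 1) → Set (Set ι))
    (hV : ∀ i, DeterminedBy (V i) (↑F : Set ι)) (hW : ∀ i, DeterminedBy (W i) (↑F : Set ι)ᶜ)
    (HV : ∀ B : Finset (Fin (n + 1)), CombPos (fun _ : ι => B.card)
      (fun p => sahiE (bernoulliWeight p) B.card (fun j => ind (V (B.orderEmbOfFin rfl j)))))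
    (HW : ∀ c : OrderedFinpartition (n + 1), CombPos (fun _ : ι => c.length)
      (fun p => sahiE (bernoulliWeight p) c.length (fun m => ind (⋂ j : Fin (block c m).card, W ((block c m).orderEmbOfFin rfl j))))) :
    CombPos (fun _ : ι => n + 1) (fun p => sahiE (bernoulliWeight p) (n + 1) (fun i => ind (V i ∩ W i))) := by
  -- each `V`-block functional ignores `Fᶜ`, the `W`-functional ignores `F`
  have HV' : ∀ (c : OrderedFinpartition (n + 1)) (m : Fin c.length),
      CombPos (fun e => if e ∈ Fᶜ then 0 else (block c m).card)
        (fun p => sahiE (bernoulliWeight p) (block c m).card (fun j => ind (V ((block c m).orderEmbOfFin rfl j)))) := by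
    intro c m
    refine (HV (block c m)).of_ignores_finset Fᶜ fun e he p s => ?_
    exact sahiE_bernoulliWeight_update_eq_of_diff p (↑F : Set ι)ᶜ (fun j => ind (V ((block c m).orderEmbOfFin rfl j)))
      (fun j ω => ind_eq_ind_diff_compl (hV ((block c m).orderEmbOfFin rfl j)) ω) (by simpa [Finset.mem_compl] using he) s
  have HW' : ∀ c : OrderedFinpartition (n + 1), CombPos (fun e => if e ∈ F then 0 else n + 1)
      (fun p => sahiE (bernoulliWeight p) c.length (fun m => ind (⋂ j : Fin (block c m).card, W ((block c m).orderEmbOfFin rfl j)))) := by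
    intro c
    refine ((HW c).mono (fun _ => c.length_le : (fun _ : ι => c.length) ≤ fun _ => n + 1)).of_ignores_finset F
      fun e he p s => ?_
    refine sahiE_bernoulliWeight_update_eq_of_diff p (↑F : Set ι) _ (fun m ω => ?_) (by simpa using he) s
    exact ind_eq_ind_diff ((determinedBy_iff _ _).2 fun ω ω' hωω' => Set.mem_iInter.trans
      ((forall_congr' fun j => (determinedBy_iff _ _).1 (hW _) ω ω' hωω').trans Set.mem_iInter.symm)) ω
  have hterm : ∀ c : OrderedFinpartition (n + 1), CombPos (fun _ : ι => n + 1) (fun p =>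
      (∏ m : Fin c.length, sahiE (bernoulliWeight p) (block c m).card (fun j => ind (V ((block c m).orderEmbOfFin rfl j)))) *
        sahiE (bernoulliWeight p) c.length (fun m => ind (⋂ j : Fin (block c m).card, W ((block c m).orderEmbOfFin rfl j)))) := by
    intro c
    refine (CombPos.prod univ (fun m _ => HV' c m)).mul_of_le (HW' c) fun e => ?_
    simp only [Pi.add_apply, Finset.sum_apply]
    by_cases he : e ∈ F
    · have : e ∉ Fᶜ := by simpa using he
      simp only [this, if_false, he, if_true, add_zero, sum_card_block]; exact le_rfl
    · have : e ∈ Fᶜ := by simpa using he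
      simp only [this, if_true, he, if_false, Finset.sum_const_zero, zero_add]; exact le_rfl
  exact (CombPos.sum univ fun c _ => hterm c).congr fun p => by
    rw [sahiE_ind_separable_eq p F V W hV hW]

/-- **(R8) at the comb level, every `k`: separable families.**  GIVEN `MasterFamilyCombPos j` for all `j ≤ n + 1`, every family of `n + 1`
increasing events of the form `V_i ∩ W_i` with the `V_i` determined by a coordinate set `F` and the `W_i` by `Fᶜ` has `E_{n+1}` comb-positive at
multidegree `n + 1`. [this work] -/
theorem combPos_sahiE_ind_separable {n : ℕ} (hN : ∀ j, j ≤ n + 1 → MasterFamilyCombPos j) (F : Finset ι)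
    (V W : Fin (n + 1) → Set (Set ι)) (hVu : ∀ i, IsUpperSet (V i)) (hWu : ∀ i, IsUpperSet (W i))
    (hV : ∀ i, DeterminedBy (V i) (↑F : Set ι)) (hW : ∀ i, DeterminedBy (W i) (↑F : Set ι)ᶜ) :
    CombPos (fun _ : ι => n + 1) (fun p => sahiE (bernoulliWeight p) (n + 1) (fun i => ind (V i ∩ W i))) := by
  refine combPos_sahiE_ind_separable_local F V W hV hW (fun B => ?_) fun c => ?_
  · have hB : B.card ≤ n + 1 := by simpa using Finset.card_le_univ B
    exact hN _ hB ι _ fun j => hVu _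
  · exact hN _ c.length_le ι _ fun m => isUpperSet_blockInter hWu c m

/-- **The block stratum (two independent GROUPS of slots) at the comb level, every `k`.**  GIVEN `MasterFamilyCombPos j` for `j ≤ n + 1`, a
family of `n + 1` increasing events whose members with `b i` are determined by `F` and the others by `Fᶜ` has `E_{n+1}` comb-positive at
multidegree `n + 1`. [this work] -/
theorem combPos_sahiE_ind_of_blocks {n : ℕ} (hN : ∀ j, j ≤ n + 1 → MasterFamilyCombPos j) (F : Finset ι)
    (U : Fin (n + 1) → Set (Set ι)) (hU : ∀ i, IsUpperSet (U i)) (b : Fin (n + 1) → Prop)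
    (hb : ∀ i, b i → DeterminedBy (U i) (↑F : Set ι)) (hb' : ∀ i, ¬ b i → DeterminedBy (U i) (↑F : Set ι)ᶜ) :
    CombPos (fun _ : ι => n + 1) (fun p => sahiE (bernoulliWeight p) (n + 1) (fun i => ind (U i))) := by
  have h := combPos_sahiE_ind_separable hN F (fun i => if b i then U i else Set.univ) (fun i => if b i then Set.univ else U i)
    (fun i => by by_cases hi : b i <;> simp only [hi, if_true, if_false, hU i, isUpperSet_univ])
    (fun i => by by_cases hi : b i <;> simp only [hi, if_true, if_false, hU i, isUpperSet_univ])
    (fun i => by by_cases hi : b i <;> simp only [hi, if_true, if_false, hb i, determinedBy_univ])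
    (fun i => by by_cases hi : b i <;> simp only [hi, if_true, if_false, hb' i, determinedBy_univ, not_false_eq_true])
  refine h.congr fun p => ?_
  congr 1
  funext i
  by_cases hi : b i <;> simp [hi]

end SahiCombTensor

end Summit.CriticalPhenomena.PercolationContinuityZ3.Theorems

end
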